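import Summits.ResolutionOfSingularities.ResolutionOfSingularities.Theorems.PurelyInseparableDim4ResConeLossyTiltFreeTail
import HarnessLib
import HarnessLib.Audit.Tags

/-!
# Purely inseparable four-folds — NO TILT-FREE BINARY-CONE TAIL at `(p, d) = (5, 4)`, WHATEVER THE PASSIVE BOUNDARY:
# the inert-boundary classes die by the ledger and the free-tail theorem
# (K2(p) lane, SLICE C, tilt-free D∞ brick, FILE 2c; file-holder res-dim4-p-5 g4)

[OURS · counted 0 · cell `res-dim4-pi` · K2(p) lane, slice C (desk WORDS #128 (h), #130 (b)) · seat p-5 g4.]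
Nothing here proves K2(p)/K2(5), `NoIsolatedTrap p p` or resolution of singularities in dimension ≥ 4 / char. `p`.

`…LossyTiltFreeTail.no_tiltFree_pair_tail_four_five` kills the tilt-free tails whose two INERT letters carry no
boundary (idea-4's D∞ proper).  This file removes that hypothesis.  On a tilt-free tail the inert letters are never
charts (`chain_letters_of_tiltFree`) and never translated (`chain_translation_passive`), so their multiplicities are
CONSTANT (`chain_passive_const`); write `P` for their sum and `A_k = r_k a + r_k a′` for the active mass.  The chart
law reads `A_{k+1} = A_k + P − 1 + (kept other active letter)` (`chain_active_succ`), with `o_k = A_k + P + 4`.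
* `P ≥ 2`: `A` grows by `≥ 1` per step, against the band `o < 10` (`false_of_passive_two_le`);
* `P = 1`: `A` is non-decreasing, `≥ 1` (floor), and `= 1` beyond every index (the upper band `o ≥ 7` cannot persist:
  `BandLayers.no_isolated_chain_eventually_upper`), so `A ≡ 1`: no step ever KEEPS the other active letter — in
  particular no step is a SATELLITE, and the free-tail theorem `FreeTailProof.noIsolatedFreeTailAt_self` produces a
  non-isolated state (`false_of_passive_one`);
* **`no_tiltFree_tail_four_five`** — HEADLINE: over a field of characteristic `5` there is NO isolated above-floor
  witnessed `Step0 5` chain with `x^{r₀} ∣ F₀`, constant shade `4` and `e_G = 2` from `k₀`, whose polar kernels all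
  contain `e_a` and `e_{a′}` for a fixed pair `a ≠ a′` (the residual cone involves only the other two letters).
NOT claimed: TILTED binary-cone tails (polar kernel not a coordinate plane; idea-4 g4's (PC) dictionary is the
announced route), other `(p, d)`; K2(5) stays OPEN.
[cite: CossartJannsenSaito2020, Thm. 3.14, Thm. 13.7] [cite: HauserPerlega2019PRIMS, §2 (transform D′ of D)]
bears_on: LADDER-RESOLUTION:D157-DOOR2 (res-dim4-pi · K2(p) = `RidgeBudget.NoAboveFloorTrap p p` · slice C, binary-cone residual,
tilt-free).  Supports stmt-ResolutionOfSingularities-16155 (helper).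
-/

set_option linter.dupNamespace false -- mandated namespace of this single-conjunct summit

noncomputable section

namespace Summit.ResolutionOfSingularities.ResolutionOfSingularities.Theorems.PIDim4

namespace ResCone

open MvPolynomial Finset
open Literature.AlgebraicGeometry.Resolution
open Literature.AlgebraicGeometry.Resolution.CentreBlowup
open Literature.AlgebraicGeometry.Resolution.Hauser2010
open Literature.AlgebraicGeometry.Resolution.HauserPerlega2019
open PointBlowup (direction)

variable {K : Type} [Field K] [CharP K 5] [DecidableEq K]

section Inert

/-- **The inert multiplicities are constant** on a tilt-free tail (inert letters are never charts, never translated).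
[OURS · bookkeeping] [cite: HauserPerlega2019PRIMS, §2 (transform D′ of D)] -/
theorem chain_passive_const {c : ℕ → State K} {j : ℕ → Fin 4} {b : ℕ → Fin 4 → K}
    (hc : ∀ k, IsIsolated 5 (c k).F ∧ Step0 5 (c k) (c (k + 1))) (hw : FreeTail.IsWitnessedChain 5 c j b)
    (hr0 : ∀ e ∈ (c 0).F.support, (c 0).r ≤ e) (hfloor : ∀ k, ordZero (c k).F ≠ 5) {k₀ : ℕ}
    (hshade : ∀ k, k₀ ≤ k → (c k).shade = ((4 : ℕ) : ℕ∞))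
    (he : ∀ k, k₀ ≤ k → Module.finrank K (resVertex (c k)) = 2) {a a' : Fin 4} (haa : a ≠ a')
    (htilt : ∀ k, k₀ ≤ k → (Pi.single a 1 : Fin 4 → K) ∈ resVertex (c k) ∧
      (Pi.single a' 1 : Fin 4 → K) ∈ resVertex (c k))
    {i : Fin 4} (hia : i ≠ a) (hia' : i ≠ a') : ∀ k, k₀ ≤ k → (c k).r i = (c k₀).r i := by
  haveI : Fact (Nat.Prime 5) := ⟨by norm_num⟩
  have hletters : ∀ k, k₀ ≤ k → (j k = a ∨ j k = a') :=
    fun k hk => chain_letters_of_tiltFree hc hw hr0 hfloor hshade he haa htilt hk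
  intro k hk
  induction k, hk using Nat.le_induction with
  | base => rfl
  | succ k hk ih =>
    rw [← ih]
    have hij : i ≠ j k := by
      rcases hletters k hk with h | h <;> rw [h]
      · exact hia
      · exact hia'
    exact step_r_apply_of_untranslated 5 hc hw hr0 hfloor hij
      (chain_translation_passive hc hw hr0 hfloor hshade he haa hletters htilt hk hia hia')

omit [CharP K 5] in
/-- **The ledger with a passive boundary**: `o_k = r_k a + r_k a′ + |r_k|_inert + 4`, `5 < o_k < 10`, `x^{r_k} ∣ F_k`.
[OURS · bookkeeping] [cite: HauserPerlega2019PRIMS, §2 (transform D′ of D)] -/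
theorem chain_order_eq {c : ℕ → State K} (hc : ∀ k, IsIsolated 5 (c k).F ∧ Step0 5 (c k) (c (k + 1)))
    (hr0 : ∀ e ∈ (c 0).F.support, (c 0).r ≤ e) (hfloor : ∀ k, ordZero (c k).F ≠ 5) {k₀ : ℕ}
    (hshade : ∀ k, k₀ ≤ k → (c k).shade = ((4 : ℕ) : ℕ∞)) {a a' : Fin 4} (haa : a ≠ a') {k : ℕ} (hk : k₀ ≤ k) :
    ∃ o : ℕ, ordZero (c k).F = o ∧
      o = (c k).r a + (c k).r a' + degIn ((Finset.univ.erase a).erase a') (c k).r + 4 ∧ 5 < o ∧ o < 10 ∧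
      (∀ e ∈ (c k).F.support, (c k).r ≤ e) := by
  haveI : Fact (Nat.Prime 5) := ⟨by norm_num⟩
  obtain ⟨o, ho, h5o, ho10⟩ := chain_band 5 hc hfloor k
  have hrk : ∀ e ∈ (c k).F.support, (c k).r ≤ e := IsolatedBand.isolated_chain_forall_le hc hr0 k
  have hd := ordZero_sub_degree_eq_of_shade ho (hshade k hk)
  have hdeg := degree_r_le ho hrk
  have hsplit := degree_eq_apply_add_apply_add_degIn haa (c k).r
  exact ⟨o, ho, by omega, h5o, by omega, hrk⟩

omit [CharP K 5] in
/-- **The active-mass law**: at a step `k ≥ k₀` with chart `c ∈ {a, a′}` the new weight of `c` is `o_k − 5` and the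
other active letter keeps its weight iff untranslated:
`A_{k+1} = A_k + |r|_inert − 1 + [b k c̄ = 0]·r_k c̄`. [OURS · bookkeeping] [cite: HauserPerlega2019PRIMS, §2] -/
theorem chain_active_succ {c : ℕ → State K} {j : ℕ → Fin 4} {b : ℕ → Fin 4 → K}
    (hc : ∀ k, IsIsolated 5 (c k).F ∧ Step0 5 (c k) (c (k + 1))) (hw : FreeTail.IsWitnessedChain 5 c j b)
    (hr0 : ∀ e ∈ (c 0).F.support, (c 0).r ≤ e) (hfloor : ∀ k, ordZero (c k).F ≠ 5) {k₀ : ℕ}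
    (hshade : ∀ k, k₀ ≤ k → (c k).shade = ((4 : ℕ) : ℕ∞)) {a a' : Fin 4} (haa : a ≠ a')
    {k : ℕ} (hk : k₀ ≤ k) {x y : Fin 4} (hxy : x ≠ y) (hjk : j k = x) :
    (c (k + 1)).r x + 5 = (c k).r a + (c k).r a' + degIn ((Finset.univ.erase a).erase a') (c k).r + 4 ∧
      (c (k + 1)).r y = if b k y = 0 then (c k).r y else 0 := by
  obtain ⟨o, ho, hosum, h5o, -, hrk⟩ := chain_order_eq hc hr0 hfloor hshade haa hk
  have law := step_r_univ 5 (j k) (hw k).2.1 (c k) ho hrk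
  rw [← (hw k).2.2.2.2, hjk] at law
  refine ⟨?_, ?_⟩
  · rw [law, Finsupp.coe_update, Function.update_self]; omega
  · rw [law, Finsupp.coe_update, Function.update_of_ne (Ne.symm hxy), Finsupp.filter_apply]

/-- **PASSIVE MASS `≥ 2` IS IMPOSSIBLE**: the active mass grows by at least `P − 1 ≥ 1` per step, against the band
`o = A + P + 4 < 10`. [OURS] [cite: HauserPerlega2019PRIMS, §2 (transform D′ of D)] -/
theorem false_of_passive_two_le {c : ℕ → State K} {j : ℕ → Fin 4} {b : ℕ → Fin 4 → K}
    (hc : ∀ k, IsIsolated 5 (c k).F ∧ Step0 5 (c k) (c (k + 1))) (hw : FreeTail.IsWitnessedChain 5 c j b)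
    (hr0 : ∀ e ∈ (c 0).F.support, (c 0).r ≤ e) (hfloor : ∀ k, ordZero (c k).F ≠ 5) {k₀ : ℕ}
    (hshade : ∀ k, k₀ ≤ k → (c k).shade = ((4 : ℕ) : ℕ∞))
    (he : ∀ k, k₀ ≤ k → Module.finrank K (resVertex (c k)) = 2) {a a' : Fin 4} (haa : a ≠ a')
    (htilt : ∀ k, k₀ ≤ k → (Pi.single a 1 : Fin 4 → K) ∈ resVertex (c k) ∧
      (Pi.single a' 1 : Fin 4 → K) ∈ resVertex (c k))
    (hP : 2 ≤ degIn ((Finset.univ.erase a).erase a') (c k₀).r) : False := by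
  haveI : Fact (Nat.Prime 5) := ⟨by norm_num⟩
  set P := (Finset.univ.erase a).erase a' with hPdef
  have hletters : ∀ k, k₀ ≤ k → (j k = a ∨ j k = a') :=
    fun k hk => chain_letters_of_tiltFree hc hw hr0 hfloor hshade he haa htilt hk
  have hconst : ∀ k, k₀ ≤ k → degIn P (c k).r = degIn P (c k₀).r := fun k hk =>
    Finset.sum_congr rfl fun i hi =>
      chain_passive_const hc hw hr0 hfloor hshade he haa htilt
        (Finset.ne_of_mem_erase (Finset.mem_of_mem_erase hi)) (Finset.ne_of_mem_erase hi) k hk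
  -- the active mass grows by at least one per step
  have hgrow : ∀ n, n + ((c k₀).r a + (c k₀).r a') ≤ (c (k₀ + n)).r a + (c (k₀ + n)).r a' := by
    intro n
    induction n with
    | zero => simp
    | succ n ih =>
      have hk : k₀ ≤ k₀ + n := Nat.le_add_right _ _
      rcases hletters (k₀ + n) hk with hja | hja'
      · obtain ⟨hx, hy⟩ := chain_active_succ hc hw hr0 hfloor hshade haa hk haa hja
        rw [← hPdef, hconst _ hk] at hx
        rw [show k₀ + (n + 1) = k₀ + n + 1 by omega]
        have : 0 ≤ (c (k₀ + n + 1)).r a' := Nat.zero_le _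
        omega
      · obtain ⟨hx, hy⟩ := chain_active_succ hc hw hr0 hfloor hshade haa hk haa.symm hja'
        rw [← hPdef, hconst _ hk] at hx
        rw [show k₀ + (n + 1) = k₀ + n + 1 by omega]
        have : 0 ≤ (c (k₀ + n + 1)).r a := Nat.zero_le _
        omega
  obtain ⟨o, -, hosum, -, ho10, -⟩ := chain_order_eq hc hr0 hfloor hshade haa (k := k₀ + 4) (by omega)
  rw [← hPdef, hconst _ (by omega)] at hosum
  have := hgrow 4
  omega

/-- **PASSIVE MASS `= 1` IS IMPOSSIBLE**: then `o = A + 5`, the active mass `A` is `≥ 1` (floor), non-decreasing, and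
`= 1` beyond every index (`BandLayers.no_isolated_chain_eventually_upper`: `o ≥ 7` cannot persist), hence `A ≡ 1`;
so no step keeps the other active letter, no step is a SATELLITE, and the free-tail theorem
`FreeTailProof.noIsolatedFreeTailAt_self` yields a non-isolated state. [OURS]
[cite: CossartJannsenSaito2020, Thm. 3.14] [cite: HauserPerlega2019PRIMS, §2 (transform D′ of D)] -/
theorem false_of_passive_one {c : ℕ → State K} {j : ℕ → Fin 4} {b : ℕ → Fin 4 → K}
    (hc : ∀ k, IsIsolated 5 (c k).F ∧ Step0 5 (c k) (c (k + 1))) (hw : FreeTail.IsWitnessedChain 5 c j b)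
    (hr0 : ∀ e ∈ (c 0).F.support, (c 0).r ≤ e) (hfloor : ∀ k, ordZero (c k).F ≠ 5) {k₀ : ℕ}
    (hshade : ∀ k, k₀ ≤ k → (c k).shade = ((4 : ℕ) : ℕ∞))
    (he : ∀ k, k₀ ≤ k → Module.finrank K (resVertex (c k)) = 2) {a a' : Fin 4} (haa : a ≠ a')
    (htilt : ∀ k, k₀ ≤ k → (Pi.single a 1 : Fin 4 → K) ∈ resVertex (c k) ∧
      (Pi.single a' 1 : Fin 4 → K) ∈ resVertex (c k))
    (hP : degIn ((Finset.univ.erase a).erase a') (c k₀).r = 1) : False := by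
  haveI : Fact (Nat.Prime 5) := ⟨by norm_num⟩
  set P := (Finset.univ.erase a).erase a' with hPdef
  have hletters : ∀ k, k₀ ≤ k → (j k = a ∨ j k = a') :=
    fun k hk => chain_letters_of_tiltFree hc hw hr0 hfloor hshade he haa htilt hk
  have hconst : ∀ k, k₀ ≤ k → degIn P (c k).r = 1 := fun k hk => by
    rw [← hP, hPdef]
    exact Finset.sum_congr rfl fun i hi =>
      chain_passive_const hc hw hr0 hfloor hshade he haa htilt
        (Finset.ne_of_mem_erase (Finset.mem_of_mem_erase hi)) (Finset.ne_of_mem_erase hi) k hk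
  -- the active-mass law at `P = 1`: `A_{k+1} = A_k + kept`
  have hlaw : ∀ k, k₀ ≤ k → ∃ y : Fin 4, (y = a ∨ y = a') ∧ y ≠ j k ∧
      (c (k + 1)).r a + (c (k + 1)).r a' =
        (c k).r a + (c k).r a' + (if b k y = 0 then (c k).r y else 0) := by
    intro k hk
    rcases hletters k hk with hja | hja'
    · obtain ⟨hx, hy⟩ := chain_active_succ hc hw hr0 hfloor hshade haa hk haa hja
      rw [← hPdef, hconst k hk] at hx
      exact ⟨a', Or.inr rfl, by rw [hja]; exact haa.symm, by rw [hy]; omega⟩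
    · obtain ⟨hx, hy⟩ := chain_active_succ hc hw hr0 hfloor hshade haa hk haa.symm hja'
      rw [← hPdef, hconst k hk] at hx
      exact ⟨a, Or.inl rfl, by rw [hja']; exact haa, by rw [hy]; omega⟩
  have hmono : ∀ k, k₀ ≤ k → (c k).r a + (c k).r a' ≤ (c (k + 1)).r a + (c (k + 1)).r a' := by
    intro k hk
    obtain ⟨y, -, -, hA⟩ := hlaw k hk
    rw [hA]; omega
  have hmono' : ∀ m k, k₀ ≤ m → m ≤ k → (c m).r a + (c m).r a' ≤ (c k).r a + (c k).r a' := by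
    intro m k hm hmk
    induction k, hmk using Nat.le_induction with
    | base => exact le_rfl
    | succ k hmk ih => exact ih.trans (hmono k (by omega))
  have hge1 : ∀ k, k₀ ≤ k → 1 ≤ (c k).r a + (c k).r a' := by
    intro k hk
    obtain ⟨o, -, hosum, h5o, -, -⟩ := chain_order_eq hc hr0 hfloor hshade haa hk
    rw [← hPdef, hconst k hk] at hosum
    omega
  -- `A ≡ 1`: otherwise `o ≥ 7` for ever from some index, against the upper-band theorem
  have hA1 : ∀ k, k₀ ≤ k → (c k).r a + (c k).r a' = 1 := by
    intro m hm
    by_contra hne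
    have h2 : 2 ≤ (c m).r a + (c m).r a' := by have := hge1 m hm; omega
    refine BandLayers.no_isolated_chain_eventually_upper 5 hc (k₀ := m) fun k hk => ?_
    obtain ⟨o, ho, hosum, -, -, -⟩ := chain_order_eq hc hr0 hfloor hshade haa (k := k) (by omega)
    rw [← hPdef, hconst k (by omega)] at hosum
    have := hmono' m k hm hk
    rw [ho]
    exact_mod_cast (show (7 : ℕ) ≤ o by omega)
  -- hence no step is a satellite
  have hfree : ∀ k, k₀ ≤ k → ¬ FreeTail.IsSatellite j b k := by
    intro k hk hsat
    obtain ⟨hjj, hb⟩ := hsat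
    -- at step `k + 1` the other active letter is `j k`, it carries weight `1` and is untranslated: `A` jumps to `2`
    obtain ⟨y, hy, hyj, hA⟩ := hlaw (k + 1) (by omega)
    have hyk : y = j k := by
      rcases hletters k hk with h | h <;> rcases hletters (k + 1) (by omega) with h' | h' <;>
        rcases hy with rfl | rfl
      all_goals first
        | exact h.symm
        | exact absurd h' hyj.symm
        | exact absurd (h'.trans h.symm) hjj
    have hnew : (c (k + 1)).r (j k) = 1 := by
      rcases hletters k hk with hja | hja'
      · obtain ⟨hx, -⟩ := chain_active_succ hc hw hr0 hfloor hshade haa hk haa hja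
        rw [← hPdef, hconst k hk, hA1 k hk] at hx
        rw [hja]; omega
      · obtain ⟨hx, -⟩ := chain_active_succ hc hw hr0 hfloor hshade haa hk haa.symm hja'
        rw [← hPdef, hconst k hk] at hx
        have h1 := hA1 k hk
        rw [hja']; omega
    rw [hyk, if_pos hb, hnew, hA1 (k + 1) (by omega), hA1 (k + 2) (by omega)] at hA
    omega
  obtain ⟨k, hk⟩ := FreeTailProof.noIsolatedFreeTailAt_self 5 K c j b k₀ hw hfree
  exact hk (hc k).1

/-- **NO TILT-FREE BINARY-CONE TAIL AT `(p, d) = (5, 4)`** (HEADLINE of the tilt-free D∞ brick, passive boundary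
included).  Over a field of characteristic `5` there is NO isolated above-floor witnessed `Step0 5` chain with
`x^{r₀} ∣ F₀`, of constant shade `4` and `e_G = 2` from `k₀` on, whose polar kernels all contain the coordinate vectors
`e_a, e_{a′}` of a fixed pair `a ≠ a′` (TILT-FREE: the residual cone is a binary quartic in the two other letters).
Passive mass `0`: `…LossyTiltFreeTail.no_tiltFree_pair_tail_four_five` (idea-4's D∞, lossy by the Frobenius row /
loss-free by res-dim4-p-5 g3's C13); passive mass `1`: `false_of_passive_one` (free tail); `≥ 2`:
`false_of_passive_two_le` (band).  Riders: TILTED binary-cone tails NOT covered; K2(5) OPEN. [OURS]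
[cite: CossartJannsenSaito2020, Thm. 3.14, Lemma 13.2, Thm. 13.7] [cite: HauserPerlega2019PRIMS, §2 (transform D′ of D)] -/
theorem no_tiltFree_tail_four_five {c : ℕ → State K} {j : ℕ → Fin 4} {b : ℕ → Fin 4 → K}
    (hc : ∀ k, IsIsolated 5 (c k).F ∧ Step0 5 (c k) (c (k + 1))) (hw : FreeTail.IsWitnessedChain 5 c j b)
    (hr0 : ∀ e ∈ (c 0).F.support, (c 0).r ≤ e) (hfloor : ∀ k, ordZero (c k).F ≠ 5) {k₀ : ℕ}
    (hshade : ∀ k, k₀ ≤ k → (c k).shade = ((4 : ℕ) : ℕ∞))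
    (he : ∀ k, k₀ ≤ k → Module.finrank K (resVertex (c k)) = 2) {a a' : Fin 4} (haa : a ≠ a')
    (htilt : ∀ k, k₀ ≤ k → (Pi.single a 1 : Fin 4 → K) ∈ resVertex (c k) ∧
      (Pi.single a' 1 : Fin 4 → K) ∈ resVertex (c k)) : False := by
  rcases Nat.lt_or_ge (degIn ((Finset.univ.erase a).erase a') (c k₀).r) 1 with h0 | h1
  · refine no_tiltFree_pair_tail_four_five hc hw hr0 hfloor hshade he haa htilt fun k hk i hia hia' => ?_
    rw [chain_passive_const hc hw hr0 hfloor hshade he haa htilt hia hia' k hk]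
    have h00 : degIn ((Finset.univ.erase a).erase a') (c k₀).r = 0 := by omega
    exact degIn_eq_zero_iff.mp h00 i (Finset.mem_erase.mpr ⟨hia', Finset.mem_erase.mpr ⟨hia, Finset.mem_univ i⟩⟩)
  · rcases Nat.lt_or_ge (degIn ((Finset.univ.erase a).erase a') (c k₀).r) 2 with h1' | h2
    · exact false_of_passive_one hc hw hr0 hfloor hshade he haa htilt (by omega)
    · exact false_of_passive_two_le hc hw hr0 hfloor hshade he haa htilt h2

end Inert

end ResCone

end Summit.ResolutionOfSingularities.ResolutionOfSingularities.Theorems.PIDim4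

end
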